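import Summits.HubbardSuperconductivity.HubbardSuperconductivity.Theorems.NodalWardXYDefs
import Summits.HubbardSuperconductivity.HubbardSuperconductivity.Theorems.NodalWardXYPerturbedXYOrderEntire
import Summits.HubbardSuperconductivity.HubbardSuperconductivity.Theorems.NodalWardXYPerturbedXYOrderReduction

/-!
# `PerturbedXYOrder` (stmt-HubbardSuperconductivity-10739) — line `schwarz-inheritance`: Laplace principle on a fixed torus

The zero-temperature limit of the plane rotator on a FIXED torus `(ℤ/Lℤ)³`: the mean energy
`⟨H⟩_{J,L}`, `H(θ) = Σ_b (1 - cos ∇_b θ) ≥ 0`, tends to `0` as `J → ∞` (`rotatorEnergyLaplace`: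
`∫_cube H e^{J Σ cos} ≤ η ∫_cube e^{J Σ cos}` for `J ≥ J₀(η, L)`).  It is the Laplace principle
(`fv_laplace`, ratio form on a finite measure space) applied to `e^{J Σ_b cos ∇_b θ} = e^{3L³J} e^{-JH}`; the
only input is that small-energy configurations have positive volume (the constant field `θ ≡ π` is an
interior point of the cube `[0,2π]^Λ` with `H = 0`).  Used by `stub_fixedVolumeStability` /
`perturbedXYOrder_volumewise` (complex stability and the crux volume by volume).
-/

noncomputable section

namespace Summit.HubbardSuperconductivity.HubbardSuperconductivity.Theorems.PerturbedXYOrder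

open MeasureTheory Literature.Probability.LatticeModels
open Summit.HubbardSuperconductivity.HubbardSuperconductivity.Theses.NodalWardXY

/-! ### The Laplace principle on a finite measure space -/

/-- Pointwise splitting bound behind the Laplace principle: for `J ≥ 0`, `0 ≤ H ≤ Hmax` and `δ > 0`,
`H e^{-JH} ≤ δ e^{-JH} + Hmax e^{-Jδ}`. -/
theorem fv_mul_exp_le_split {J H Hmax δ : ℝ} (hJ : 0 ≤ J) (hH0 : 0 ≤ H) (hHm : H ≤ Hmax) (hδ : 0 < δ) :
    H * Real.exp (-J * H) ≤ δ * Real.exp (-J * H) + Hmax * Real.exp (-J * δ) := by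
  have hHmax : 0 ≤ Hmax := hH0.trans hHm
  by_cases hle : H ≤ δ
  · have h1 : H * Real.exp (-J * H) ≤ δ * Real.exp (-J * H) :=
      mul_le_mul_of_nonneg_right hle (Real.exp_pos _).le
    have h2 : 0 ≤ Hmax * Real.exp (-J * δ) := mul_nonneg hHmax (Real.exp_pos _).le
    linarith
  · have hlt : δ < H := not_le.1 hle
    have h1 : Real.exp (-J * H) ≤ Real.exp (-J * δ) := Real.exp_le_exp.2 (by nlinarith)
    have h2 : H * Real.exp (-J * H) ≤ Hmax * Real.exp (-J * δ) :=
      mul_le_mul hHm h1 (Real.exp_pos _).le hHmax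
    have h3 : 0 ≤ δ * Real.exp (-J * H) := mul_nonneg hδ.le (Real.exp_pos _).le
    linarith

/-- **Laplace principle (ratio form).** On a finite measure space let `0 ≤ H ≤ Hmax` be measurable with
`ν {H ≤ δ} > 0` for every `δ > 0` (the infimum `0` is essential).  Then for every `η > 0` there is `J₀` such
that `∫ H e^{-JH} dν ≤ η ∫ e^{-JH} dν` for all `J ≥ J₀`, i.e. `E_J[H] → 0` for the tilted probability
measures `e^{-JH} dν / ∫ e^{-JH} dν`. [folklore] -/
theorem fv_laplace {X : Type*} [MeasurableSpace X] (ν : Measure X) [IsFiniteMeasure ν] {H : X → ℝ}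
    (hH : Measurable H) (hH0 : ∀ x, 0 ≤ H x) {Hmax : ℝ} (hHm : ∀ x, H x ≤ Hmax)
    (hpos : ∀ δ : ℝ, 0 < δ → 0 < ν {x | H x ≤ δ}) {η : ℝ} (hη : 0 < η) :
    ∃ J₀ : ℝ, ∀ J : ℝ, J₀ ≤ J →
      ∫ x, H x * Real.exp (-J * H x) ∂ν ≤ η * ∫ x, Real.exp (-J * H x) ∂ν := by
  set δ : ℝ := η / 2 with hδdef
  have hδ : 0 < δ := by positivity
  set S : Set X := {x | H x ≤ δ / 2} with hSdef
  have hSm : MeasurableSet S := measurableSet_le hH measurable_const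
  set v : ℝ := (ν S).toReal with hvdef
  have hv : 0 < v := ENNReal.toReal_pos (hpos (δ / 2) (by positivity)).ne' (measure_ne_top ν S)
  set U : ℝ := (ν Set.univ).toReal with hUdef
  have hU : 0 ≤ U := ENNReal.toReal_nonneg
  -- `Hmax ≥ 0` as soon as `X` is nonempty; in general we only use `max Hmax 0`.
  set c : ℝ := δ * v / (max Hmax 0 * U + 1) with hcdef
  have hden : 0 < max Hmax 0 * U + 1 := by positivity
  have hc : 0 < c := by positivity
  have hcle : max Hmax 0 * U * c ≤ δ * v := by
    rw [hcdef, mul_div_assoc']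
    rw [div_le_iff₀ hden]
    have : 0 ≤ δ * v := by positivity
    nlinarith [le_max_right Hmax 0]
  refine ⟨max 0 (-2 * Real.log c / δ), fun J hJ => ?_⟩
  have hJ0 : 0 ≤ J := le_trans (le_max_left _ _) hJ
  have hJc : Real.exp (-J * (δ / 2)) ≤ c := by
    have h1 : -2 * Real.log c / δ ≤ J := le_trans (le_max_right _ _) hJ
    have h2 : -J * (δ / 2) ≤ Real.log c := by
      rw [div_le_iff₀ hδ] at h1
      linarith
    calc Real.exp (-J * (δ / 2)) ≤ Real.exp (Real.log c) := Real.exp_le_exp.2 h2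
      _ = c := Real.exp_log hc
  -- integrability of everything in sight (bounded measurable functions on a finite measure space)
  have hEm : ∀ J : ℝ, Measurable fun x => Real.exp (-J * H x) := fun J =>
    Real.measurable_exp.comp (hH.const_mul _)
  have hEb : ∀ x, ‖Real.exp (-J * H x)‖ ≤ 1 := fun x => by
    rw [Real.norm_eq_abs, Real.abs_exp]
    exact Real.exp_le_one_iff.2 (by nlinarith [hH0 x])
  have hEi : Integrable (fun x => Real.exp (-J * H x)) ν :=
    Integrable.of_bound (hEm J).aestronglyMeasurable 1 (ae_of_all _ hEb)
  have hHEi : Integrable (fun x => H x * Real.exp (-J * H x)) ν := by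
    refine Integrable.of_bound (hH.mul (hEm J)).aestronglyMeasurable (max Hmax 0 * 1) (ae_of_all _ fun x => ?_)
    rw [norm_mul, Real.norm_eq_abs, abs_of_nonneg (hH0 x)]
    exact mul_le_mul ((hHm x).trans (le_max_left _ _)) (hEb x) (norm_nonneg _) (le_max_right _ _)
  -- upper bound: `∫ H e^{-JH} ≤ δ ∫ e^{-JH} + Hmax e^{-Jδ} ν(X)`
  have hup : ∫ x, H x * Real.exp (-J * H x) ∂ν ≤
      δ * ∫ x, Real.exp (-J * H x) ∂ν + max Hmax 0 * Real.exp (-J * δ) * U := by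
    have hpt : ∀ x, H x * Real.exp (-J * H x) ≤
        δ * Real.exp (-J * H x) + max Hmax 0 * Real.exp (-J * δ) := fun x =>
      fv_mul_exp_le_split hJ0 (hH0 x) ((hHm x).trans (le_max_left _ _)) hδ
    calc ∫ x, H x * Real.exp (-J * H x) ∂ν
        ≤ ∫ x, (δ * Real.exp (-J * H x) + max Hmax 0 * Real.exp (-J * δ)) ∂ν :=
          integral_mono hHEi ((hEi.const_mul δ).add (integrable_const _)) hpt
      _ = δ * ∫ x, Real.exp (-J * H x) ∂ν + max Hmax 0 * Real.exp (-J * δ) * U := by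
          rw [integral_add (hEi.const_mul δ) (integrable_const _), integral_const_mul, integral_const,
            smul_eq_mul, hUdef, Measure.real]
          ring
  -- lower bound: `∫ e^{-JH} ≥ e^{-Jδ/2} ν(S)`
  have hlow : Real.exp (-J * (δ / 2)) * v ≤ ∫ x, Real.exp (-J * H x) ∂ν := by
    have h1 : ∫ x in S, Real.exp (-J * (δ / 2)) ∂ν ≤ ∫ x in S, Real.exp (-J * H x) ∂ν := by
      refine setIntegral_mono_on (integrable_const _).integrableOn hEi.integrableOn hSm fun x hx => ?_
      exact Real.exp_le_exp.2 (by nlinarith [hx.out])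
    have h2 : ∫ x in S, Real.exp (-J * H x) ∂ν ≤ ∫ x, Real.exp (-J * H x) ∂ν :=
      setIntegral_le_integral hEi (ae_of_all _ fun x => (Real.exp_pos _).le)
    have h0 : ∫ x in S, Real.exp (-J * (δ / 2)) ∂ν = Real.exp (-J * (δ / 2)) * v := by
      rw [setIntegral_const, smul_eq_mul, hvdef, Measure.real, mul_comm]
    linarith
  -- combine
  have hexp : Real.exp (-J * δ) = Real.exp (-J * (δ / 2)) * Real.exp (-J * (δ / 2)) := by
    rw [← Real.exp_add]; ring_nf
  have htail : max Hmax 0 * Real.exp (-J * δ) * U ≤ δ * ∫ x, Real.exp (-J * H x) ∂ν := by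
    have hMU : 0 ≤ max Hmax 0 * U := mul_nonneg (le_max_right _ _) hU
    calc max Hmax 0 * Real.exp (-J * δ) * U
        = (max Hmax 0 * U * Real.exp (-J * (δ / 2))) * Real.exp (-J * (δ / 2)) := by rw [hexp]; ring
      _ ≤ (max Hmax 0 * U * c) * Real.exp (-J * (δ / 2)) :=
          mul_le_mul_of_nonneg_right (mul_le_mul_of_nonneg_left hJc hMU) (Real.exp_pos _).le
      _ ≤ (δ * v) * Real.exp (-J * (δ / 2)) := by gcongr
      _ = δ * (Real.exp (-J * (δ / 2)) * v) := by ring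
      _ ≤ δ * ∫ x, Real.exp (-J * H x) ∂ν := by gcongr
  calc ∫ x, H x * Real.exp (-J * H x) ∂ν
      ≤ δ * ∫ x, Real.exp (-J * H x) ∂ν + max Hmax 0 * Real.exp (-J * δ) * U := hup
    _ ≤ δ * ∫ x, Real.exp (-J * H x) ∂ν + δ * ∫ x, Real.exp (-J * H x) ∂ν := by linarith
    _ = η * ∫ x, Real.exp (-J * H x) ∂ν := by rw [hδdef]; ring

/-! ### The rotator energy `H(θ) = Σ_b (1 - cos ∇_b θ)` on the cube -/

variable {L : ℕ}

/-- The energy `H(θ) = Σ_b (1 - cos ∇_b θ)` is non-negative. -/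
theorem fv_energy_nonneg [NeZero L] (θ : TorusSite 3 L → ℝ) :
    0 ≤ ∑ b : Bond L, (1 - Real.cos (θ (b.1 + Pi.single b.2 1) - θ b.1)) :=
  Finset.sum_nonneg fun _ _ => sub_nonneg.2 (Real.cos_le_one _)

/-- The energy is at most `2 · #bonds = 6 L³`. -/
theorem fv_energy_le [NeZero L] (θ : TorusSite 3 L → ℝ) :
    ∑ b : Bond L, (1 - Real.cos (θ (b.1 + Pi.single b.2 1) - θ b.1)) ≤ 6 * (L : ℝ) ^ 3 := by
  calc ∑ b : Bond L, (1 - Real.cos (θ (b.1 + Pi.single b.2 1) - θ b.1)) ≤ ∑ _b : Bond L, (2 : ℝ) := by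
        gcongr with b _
        linarith [Real.neg_one_le_cos (θ (b.1 + Pi.single b.2 1) - θ b.1)]
    _ = 6 * (L : ℝ) ^ 3 := by
        simp only [Finset.sum_const, Finset.card_univ, nsmul_eq_mul, Fintype.card_prod, Fintype.card_fun,
          Fintype.card_fin, ZMod.card]
        push_cast; ring

/-- The energy is continuous (hence measurable) in the angle field. -/
theorem fv_continuous_energy [NeZero L] :
    Continuous fun θ : TorusSite 3 L → ℝ => ∑ b : Bond L, (1 - Real.cos (θ (b.1 + Pi.single b.2 1) - θ b.1)) := by
  fun_prop

/-- The real weight is `e^{3 L³ J} e^{-J H}`: `J Σ_b cos ∇_b θ = 3 L³ J + (-J) · H(θ)`. -/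
theorem fv_weight_eq [NeZero L] (J : ℝ) (θ : TorusSite 3 L → ℝ) :
    Real.exp (J * ∑ b : Bond L, Real.cos (θ (b.1 + Pi.single b.2 1) - θ b.1)) =
      Real.exp (3 * (L : ℝ) ^ 3 * J) *
        Real.exp (-J * ∑ b : Bond L, (1 - Real.cos (θ (b.1 + Pi.single b.2 1) - θ b.1))) := by
  rw [← Real.exp_add]
  congr 1
  rw [Finset.sum_sub_distrib]
  simp only [Finset.sum_const, Finset.card_univ, nsmul_eq_mul, Fintype.card_prod, Fintype.card_fun,
    Fintype.card_fin, ZMod.card]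
  push_cast; ring

/-- Small-energy configurations have positive volume in the cube: the constant field `θ ≡ π` is an interior
point of the cube with `H = 0`, and `H` is continuous. -/
theorem fv_volume_energy_le_pos [NeZero L] {δ : ℝ} (hδ : 0 < δ) :
    0 < (volume.restrict (cube L))
      {θ : TorusSite 3 L → ℝ | ∑ b : Bond L, (1 - Real.cos (θ (b.1 + Pi.single b.2 1) - θ b.1)) ≤ δ} := by
  set H : (TorusSite 3 L → ℝ) → ℝ := fun θ => ∑ b : Bond L, (1 - Real.cos (θ (b.1 + Pi.single b.2 1) - θ b.1))
    with hHdef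
  set θ₀ : TorusSite 3 L → ℝ := fun _ => Real.pi with hθ₀
  have hH0 : H θ₀ = 0 := by simp [hHdef, hθ₀]
  have hopen : IsOpen {θ : TorusSite 3 L → ℝ | H θ < δ} := isOpen_lt fv_continuous_energy continuous_const
  have hmem : θ₀ ∈ {θ : TorusSite 3 L → ℝ | H θ < δ} := by
    show H θ₀ < δ
    rw [hH0]; exact hδ
  obtain ⟨ρ, hρ, hball⟩ := Metric.isOpen_iff.1 hopen θ₀ hmem
  set r : ℝ := min ρ Real.pi with hr
  have hrpos : 0 < r := lt_min hρ Real.pi_pos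
  have hsub : Metric.ball θ₀ r ⊆ {θ | H θ ≤ δ} ∩ cube L := by
    intro θ hθ
    have hlt : H θ < δ := hball (Metric.ball_subset_ball (min_le_left _ _) hθ)
    refine ⟨hlt.le, ?_⟩
    rw [Metric.mem_ball] at hθ
    have hθ' : ∀ x, dist (θ x) (θ₀ x) < r := fun x => lt_of_le_of_lt (dist_le_pi_dist θ θ₀ x) hθ
    refine Set.mem_univ_pi.2 fun x => ?_
    have hx := hθ' x
    rw [Real.dist_eq] at hx
    have hxr : |θ x - Real.pi| < Real.pi := lt_of_lt_of_le hx (min_le_right _ _)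
    rw [abs_lt] at hxr
    constructor <;> linarith
  calc (0 : ENNReal) < volume (Metric.ball θ₀ r) := Metric.measure_ball_pos volume θ₀ hrpos
    _ ≤ volume ({θ | H θ ≤ δ} ∩ cube L) := measure_mono hsub
    _ = (volume.restrict (cube L)) {θ | H θ ≤ δ} := by
        rw [Measure.restrict_apply (measurableSet_le fv_continuous_energy.measurable measurable_const)]

/-- **Laplace principle for the rotator on a fixed torus**: for every `η > 0` there is `J₀` such that
`∫_cube H e^{J Σ cos} ≤ η ∫_cube e^{J Σ cos}` for `J ≥ J₀`, i.e. `⟨Σ_b (1 - cos ∇_b θ)⟩_{J,L} → 0` as `J → ∞`. -/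
theorem rotatorEnergyLaplace : ∀ (L : ℕ) [NeZero L] (η : ℝ), 0 < η →
    ∃ J₀ : ℝ, ∀ J : ℝ, J₀ ≤ J →
      ∫ θ in cube L, (∑ b : Bond L, (1 - Real.cos (θ (b.1 + Pi.single b.2 1) - θ b.1))) *
          Real.exp (J * ∑ b : Bond L, Real.cos (θ (b.1 + Pi.single b.2 1) - θ b.1)) ≤
        η * ∫ θ in cube L, Real.exp (J * ∑ b : Bond L, Real.cos (θ (b.1 + Pi.single b.2 1) - θ b.1)) := by
  intro L _ η hη
  haveI := ent_isFiniteMeasure_restrict_cube (L := L)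
  obtain ⟨J₀, hJ₀⟩ := fv_laplace (volume.restrict (cube L)) fv_continuous_energy.measurable
    fv_energy_nonneg fv_energy_le (fun δ hδ => fv_volume_energy_le_pos hδ) hη
  refine ⟨J₀, fun J hJ => ?_⟩
  have h := hJ₀ J hJ
  simp_rw [fv_weight_eq J]
  have e1 : ∀ θ : TorusSite 3 L → ℝ,
      (∑ b : Bond L, (1 - Real.cos (θ (b.1 + Pi.single b.2 1) - θ b.1))) *
        (Real.exp (3 * (L : ℝ) ^ 3 * J) *
          Real.exp (-J * ∑ b : Bond L, (1 - Real.cos (θ (b.1 + Pi.single b.2 1) - θ b.1)))) =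
      Real.exp (3 * (L : ℝ) ^ 3 * J) *
        ((∑ b : Bond L, (1 - Real.cos (θ (b.1 + Pi.single b.2 1) - θ b.1))) *
          Real.exp (-J * ∑ b : Bond L, (1 - Real.cos (θ (b.1 + Pi.single b.2 1) - θ b.1)))) :=
    fun θ => by ring
  simp_rw [e1, integral_const_mul]
  rw [mul_left_comm]
  exact mul_le_mul_of_nonneg_left h (Real.exp_pos _).le

end Summit.HubbardSuperconductivity.HubbardSuperconductivity.Theorems.PerturbedXYOrder

end
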